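import Literature.MathematicalPhysics.QuantumLattice.QuasiLocalAlgebraDynamicsProofs
import Mathlib.Analysis.CStarAlgebra.Exponential
import Mathlib.Algebra.Star.UnitaryStarAlgAut
import Mathlib.Analysis.SpecialFunctions.Exponential
import HarnessLib

/-!
# Discharged fact: existence of the dynamics of a bounded finite-range interaction
(`QuasiLocalAlgebra.exists_dynamics`, Bratteli–Robinson II Thm. 6.2.4)

This file contains only theorems. It discharges the named fact
`Literature.MathematicalPhysics.QuantumLattice.QuasiLocalAlgebra.exists_dynamics` of
`Literature.MathematicalPhysics.QuantumLattice.QuasiLocalAlgebra`: a Hermitian lattice interaction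
`Φ` of finite range `R` with uniformly bounded terms (`‖Φ X‖ ≤ J`) generates a *unique* strongly
continuous one-parameter group `τ` of ⋆-automorphisms of the quasi-local algebra `𝔄` whose
generator on the local algebra is the commutator derivation,
`d/dt τ_t(ι_Λ A)|_{t=0} = ι_{Λ_R}(i[H_{Λ_R}, A])` (`𝔄.IsDynamicsOf τ Φ R`), as
`QuasiLocalAlgebra.exists_dynamics_holds`. It is a sibling of
`QuasiLocalAlgebraDynamicsProofs.lean`, which proved the uniqueness half
(`IsDynamicsOf.eq_of_isDynamicsOf`, analyticity of local elements with Ruelle's uniform radius)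
and which it imports; this file supplies the existence half.

## Proof (Ruelle 1969, Thm. 7.6.2 (a)–(d), pp. 169–170; Bratteli–Robinson II Thm. 6.2.4)

The dynamics is constructed, exactly as printed, as the limit of the local dynamics
`τ^{Λ'}_t(a) = e^{itH_{Λ'}} a e^{-itH_{Λ'}}`, `H_{Λ'} = Σ_{X ⊆ Λ'} ι_X(Φ X)`, along `Λ' → ℤ^d`
(`Filter.atTop` on `Finset (Site d)`, Ruelle's "Λ eventually contains every finite subset").
* `exists_isAutomorphismGroup_inner`: for self-adjoint `h ∈ 𝔄`, `a ↦ e^{ith} a e^{-ith}` (Mathlib's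
  `selfAdjoint.expUnitary`, `Unitary.conjStarAlgAut`) is a strongly continuous automorphism group
  with generator `i[h, ·]` at `t = 0` (the inner, norm-continuous case of Bratteli–Robinson I
  Cor. 3.2.49).
* (a) `tendsto_cutoff_ι`: for a local `a = ι_Λ(A)` and `|t| K < 1`, `K = 2 J 2^m e^m`
  (`m = (2⌊R⌋+1)^d`), the Taylor series of `τ^{Λ'}_t(a)` (`IsAutomorphismGroup.tendsto_taylor` of the
  sibling file) has a geometric tail *uniformly in `Λ'`* — Ruelle's chain estimate Lemma 7.6.1 for
  the cut-off derivation `i[H_{Λ'}, ·]` with `Λ'` arbitrary, `norm_iterate_cutoff_le(_factorial)` —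
  and its `n`-th term is independent of `Λ'` as soon as `Λ' ⊇ Λ_n`, the `n`-th iterated
  `R`-neighbourhood (`iterate_cutoff_eq_iterate_genStep`, locality); hence the net
  `Λ' ↦ τ^{Λ'}_t(a)` converges ("term by term", Ruelle (6.8)–(6.9)).
* (b) `tendsto_cutoff_of_small`: the `τ^{Λ'}_t` are isometries and the local algebra is dense, so
  the net is Cauchy for every `a ∈ 𝔄` (`𝔄` is complete).
* (c) `tendsto_cutoff`: `τ^{Λ'}_{s+s'} = τ^{Λ'}_s τ^{Λ'}_{s'}` extends convergence to all `t ∈ ℝ`;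
  `exists_isAutomorphismGroup_tendsto_cutoff`: the pointwise limits `τ_t` are ⋆-automorphisms forming
  a one-parameter group (the algebraic identities pass to the limit by isometry,
  `tendsto_starAlgEquiv_apply_of_tendsto`).
* (d) strong continuity: `‖τ^{Λ'}_t(ι_Λ A) - ι_Λ A‖ ≤ |t| · 2J 2^m |Λ| ‖ι_Λ A‖` uniformly in `Λ'`
  (`norm_cutoff_apply_sub_le`, mean value inequality with Ruelle's (6.16)), density and the group
  law.
* Generator (Bratteli–Robinson II Thm. 6.2.4, `𝔄_Λ ⊆ D(δ)`): `hasDerivAt_of_tendsto_cutoff` — for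
  `Λ' ⊇ (Λ_R)_R` the generator of `τ^{Λ'}` acts on `a` and on `δ(a)` as the intrinsic `δ`, so two
  mean value inequalities give `‖τ^{Λ'}_t(a) - a - tδ(a)‖ ≤ t²‖δ²(a)‖` uniformly in `Λ'`; the bound
  passes to the limit and yields `d/dt τ_t(a)|₀ = δ(a) = ι_{Λ_R}(δ_Λ A)` (`ι_derivation`).
* `exists_dynamics_holds` assembles existence with the uniqueness theorem
  `IsDynamicsOf.eq_of_isDynamicsOf`; the hypothesis `‖ι_X(Φ X)‖ ≤ J` of both follows from
  `Φ.IsBounded J` because ⋆-homomorphisms between C⋆-algebras are contractive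
  (Mathlib `NonUnitalStarAlgHom.norm_apply_le`; the matrix algebras `𝔄_X` carry the L²-operator
  norm), and `H_{Λ'}` is self-adjoint because `Φ` is Hermitian.

## Design notes

* Theorems only: the local dynamics is packaged as an existence statement
  (`exists_isAutomorphismGroup_inner`) and enters the limit theorems of the section `Limit` through
  the hypotheses `hσ` (automorphism groups) and `hσ'` (generator `i[H_{Λ'}, ·]` at `0`); the cut-off
  derivation `F = i[H_P, ·]` enters the chain estimates through the defining hypothesis `hF`
  (section `Cutoff`), like `G`/`hG` in the sibling file.
* Everything is computed inside the C⋆-algebra `𝔄`; the only facts about `𝔄` used are the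
  structure fields `ι_compatible`, `ι_commute_of_disjoint`, `dense_range`, completeness, and
  Mathlib's automatic isometry of ⋆-automorphisms (`StarAlgEquiv.norm_map`).

## References

* O. Bratteli, D. W. Robinson, *Operator Algebras and Quantum Statistical Mechanics II*
  (2nd ed., Springer 1997), §6.2.1, Thm. 6.2.4 (existence and uniqueness of the dynamics for
  `‖Φ‖_λ < ∞`, `τ_t(A) = lim_Λ e^{itH_Φ(Λ)} A e^{-itH_Φ(Λ)}`, `𝔄_Λ ⊆ D(δ)`; not held locally,
  acquisition requested (acq-00244) — the statement used is the one vendored in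
  `QuasiLocalAlgebra.lean`). [BratteliRobinsonII1997]
* D. Ruelle, *Statistical Mechanics: Rigorous Results* (Benjamin 1969), §7.6, pp. 168–171:
  Lemma 7.6.1 (eqs. (6.4)–(6.6), the chain estimate for `[H_Φ(Λ), A]^{(n)}`, uniform in `Λ`),
  Thm. 7.6.2 (a)–(d) (the time evolution as `lim_Λ e^{itH_Φ(Λ)} A e^{-itH_Φ(Λ)}`: power series for
  `|t| < (2‖Φ‖₁)⁻¹`, extension by continuity, group law for all `t`, strong continuity),
  eq. (6.16) (`‖[A, H(Λ)]‖ ≤ 2 N(Λ₁) ‖A‖ ‖Φ‖`). [Ruelle1969]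
* O. Bratteli, D. W. Robinson, *Operator Algebras and Quantum Statistical Mechanics I*
  (2nd ed., Springer 1987), Def. 2.7.1 (C⋆-dynamical systems), Cor. 3.2.49 (everywhere-defined
  symmetric derivations generate norm-continuous automorphism groups). [BratteliRobinsonI1987]
* S. Sakai, *Operator Algebras in Dynamical Systems* (Cambridge University Press 1991), §3.4
  (analytic elements), §4.1 (finite-range interactions). [Sakai1991]
-/

noncomputable section

open Matrix Complex Finset Filter Topology
open scoped Matrix.Norms.L2Operator ComplexOrder InnerProductSpace Nat

namespace Literature.MathematicalPhysics.QuantumLattice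

section CStar

variable {A : Type*} [CStarAlgebra A]

/-- **Inner one-parameter automorphism groups.** For a self-adjoint element `h` of a unital
C⋆-algebra, `σ_t(a) = e^{ith} a e^{-ith}` is a strongly continuous one-parameter group of
⋆-automorphisms with (bounded) generator `δ(a) = i[h, a]`: `d/dt σ_t(a)|_{t=0} = i(ha - ah)`
(the inner, norm-continuous case of Bratteli–Robinson I Cor. 3.2.49; the local dynamics
`τ^Λ_t(A) = e^{itH_Φ(Λ)} A e^{-itH_Φ(Λ)}` of Bratteli–Robinson II Thm. 6.2.4 and Ruelle (1969)
eq. (6.2)). Built from Mathlib's `selfAdjoint.expUnitary` and `Unitary.conjStarAlgAut`. [folklore] -/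
theorem exists_isAutomorphismGroup_inner {h : A} (hh : IsSelfAdjoint h) :
    ∃ σ : ℝ → (A ≃⋆ₐ[ℂ] A), IsAutomorphismGroup σ ∧
      (∀ (t : ℝ) (a : A), σ t a =
        NormedSpace.exp (t • (I • h)) * a * NormedSpace.exp (t • (-(I • h)))) ∧
      ∀ a : A, HasDerivAt (fun t : ℝ => σ t a) (I • (h * a - a * h)) 0 := by
  set h₀ : selfAdjoint A := ⟨h, hh⟩ with hh₀
  set σ : ℝ → (A ≃⋆ₐ[ℂ] A) := fun t =>
    Unitary.conjStarAlgAut ℂ A (selfAdjoint.expUnitary (t • h₀)) with hσ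
  have hcoe : ∀ t : ℝ, ((selfAdjoint.expUnitary (t • h₀) : unitary A) : A) =
      NormedSpace.exp (t • (I • h)) := by
    intro t
    rw [selfAdjoint.expUnitary_coe, selfAdjoint.val_smul, smul_comm]
  have hstar : ∀ t : ℝ, star (NormedSpace.exp (t • (I • h))) =
      NormedSpace.exp (t • (-(I • h))) := by
    intro t
    rw [NormedSpace.star_exp, star_smul, star_smul, hh.star_eq, star_trivial, star_def, conj_I,
      neg_smul]
  have hformula : ∀ (t : ℝ) (a : A), σ t a =
      NormedSpace.exp (t • (I • h)) * a * NormedSpace.exp (t • (-(I • h))) := by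
    intro t a
    rw [hσ]
    simp only [Unitary.conjStarAlgAut_apply]
    rw [hcoe, hstar]
  refine ⟨σ, ⟨?_, ?_, ?_⟩, hformula, ?_⟩
  · ext a
    simp [hσ]
  · intro s t
    have hc : Commute ((s • h₀ : selfAdjoint A) : A) ((t • h₀ : selfAdjoint A) : A) := by
      rw [selfAdjoint.val_smul, selfAdjoint.val_smul]
      exact ((Commute.refl (h₀ : A)).smul_left s).smul_right t
    ext a
    simp only [hσ, add_smul, hc.expUnitary_add, map_mul, StarAlgEquiv.mul_apply,
      StarAlgEquiv.trans_apply]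
  · intro a
    simp only [hformula]
    have h1 : Continuous fun t : ℝ => NormedSpace.exp (t • (I • h)) :=
      continuous_iff_continuousAt.2 fun t =>
        (hasDerivAt_exp_smul_const' (𝕂 := ℝ) (I • h) t).continuousAt
    have h2 : Continuous fun t : ℝ => NormedSpace.exp (t • (-(I • h))) :=
      continuous_iff_continuousAt.2 fun t =>
        (hasDerivAt_exp_smul_const' (𝕂 := ℝ) (-(I • h)) t).continuousAt
    exact (h1.mul continuous_const).mul h2
  · intro a
    have hf : (fun t : ℝ => σ t a) =
        fun t => NormedSpace.exp (t • (I • h)) * a * NormedSpace.exp (t • (-(I • h))) :=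
      funext fun t => hformula t a
    rw [hf]
    have h1 := hasDerivAt_exp_smul_const' (𝕂 := ℝ) (I • h) (0 : ℝ)
    have h2 := hasDerivAt_exp_smul_const (𝕂 := ℝ) (-(I • h)) (0 : ℝ)
    have := (h1.mul_const a).mul h2
    simp only [zero_smul, NormedSpace.exp_zero] at this
    refine this.congr_deriv ?_
    simp only [mul_one, one_mul, mul_neg, smul_mul_assoc, mul_smul_comm, sub_eq_add_neg, smul_add,
      smul_neg]

/-- **Joint convergence under a family of automorphisms.** If `u_i → b` and `e_i(b) → c` for
⋆-automorphisms `e_i` (which are isometric), then `e_i(u_i) → c`. Ruelle (1969) Thm. 7.6.2 (c)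
(proof, extension of the group law to the limit dynamics). [folklore] -/
theorem tendsto_starAlgEquiv_apply_of_tendsto {β : Type*} {l : Filter β} (e : β → (A ≃⋆ₐ[ℂ] A))
    {u : β → A} {b c : A} (hu : Tendsto u l (𝓝 b)) (he : Tendsto (fun i => e i b) l (𝓝 c)) :
    Tendsto (fun i => e i (u i)) l (𝓝 c) := by
  rw [tendsto_iff_norm_sub_tendsto_zero] at hu he ⊢
  have hle : ∀ i, ‖e i (u i) - c‖ ≤ ‖u i - b‖ + ‖e i b - c‖ := fun i => by
    calc ‖e i (u i) - c‖ = ‖(e i (u i) - e i b) + (e i b - c)‖ := by rw [sub_add_sub_cancel]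
      _ ≤ ‖e i (u i) - e i b‖ + ‖e i b - c‖ := norm_add_le _ _
      _ = ‖u i - b‖ + ‖e i b - c‖ := by rw [← map_sub, StarAlgEquiv.norm_map]
  refine squeeze_zero (fun i => norm_nonneg _) hle ?_
  simpa using hu.add he

/-- Consecutive Taylor polynomials `Σ_{n ≤ N} (tⁿ/n!) x_n` of a chain with `‖x_n‖ ≤ C n! Kⁿ` differ
by at most `C (|t|K)^{N+1}` (a geometric bound). Ruelle (1969) Thm. 7.6.2 (a), eq. (6.4);
Bratteli–Robinson II Thm. 6.2.4 (proof). [folklore] -/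
theorem dist_taylor_succ_le (x : ℕ → A) {C K : ℝ} (hb : ∀ n, ‖x n‖ ≤ C * n ! * K ^ n)
    (t : ℝ) (N : ℕ) :
    dist (∑ n ∈ range (N + 1), (t ^ n / n ! : ℝ) • x n)
      (∑ n ∈ range (N + 1 + 1), (t ^ n / n ! : ℝ) • x n) ≤ C * (|t| * K) * (|t| * K) ^ N := by
  rw [dist_comm, dist_eq_norm, sum_range_succ _ (N + 1), add_sub_cancel_left, norm_smul,
    Real.norm_eq_abs, abs_div, abs_pow, Nat.abs_cast]
  have hfac : (0 : ℝ) < (N + 1)! := by positivity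
  calc |t| ^ (N + 1) / (N + 1)! * ‖x (N + 1)‖
      ≤ |t| ^ (N + 1) / (N + 1)! * (C * (N + 1)! * K ^ (N + 1)) :=
        mul_le_mul_of_nonneg_left (hb (N + 1)) (by positivity)
    _ = C * (|t| * K) * (|t| * K) ^ N := by
        field_simp
        ring

namespace IsAutomorphismGroup

/-- **Taylor remainder for analytic chains.** For a strongly continuous automorphism group `τ` and
a chain `x` of derivatives at `0` with `‖x_n‖ ≤ C n! Kⁿ`, for `|t| K < 1` the `N`-th Taylor
polynomial is within `C (|t|K)^{N+1} / (1 - |t|K)` of `τ_t(x_0)` (geometric tail of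
`tendsto_taylor`). Ruelle (1969) Thm. 7.6.2 (a), (d), pp. 169–170; Bratteli–Robinson II
Thm. 6.2.4 (proof). [cite: Ruelle1969, Thm. 7.6.2 (a), p. 169] -/
theorem dist_taylor_le {τ : ℝ → (A ≃⋆ₐ[ℂ] A)} (hτ : IsAutomorphismGroup τ) (x : ℕ → A)
    (hx : ∀ n, HasDerivAt (fun t => τ t (x n)) (x (n + 1)) 0) {C K : ℝ} (hK : 0 ≤ K)
    (hb : ∀ n, ‖x n‖ ≤ C * n ! * K ^ n) {t : ℝ} (ht : |t| * K < 1) (N : ℕ) :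
    dist (∑ n ∈ range (N + 1), (t ^ n / n ! : ℝ) • x n) (τ t (x 0)) ≤
      C * (|t| * K) * (|t| * K) ^ N / (1 - |t| * K) :=
  dist_le_of_le_geometric_of_tendsto (|t| * K) (C * (|t| * K)) ht
    (dist_taylor_succ_le x hb t) (hτ.tendsto_taylor x hx hK hb ht) N

end IsAutomorphismGroup

end CStar

section QLattice

open Literature.Probability.LatticeModels
open Literature.Probability.LatticeModels (Site box mem_box)

variable {d q : ℕ}

/-- The iterated `R`-neighbourhoods `Λ ⊆ Λ_R ⊆ (Λ_R)_R ⊆ ⋯` increase. Bratteli–Robinson II §6.2.1.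
[folklore] -/
theorem thicken_iterate_mono (Λ : Finset (Site d)) (R : ℝ) {k n : ℕ} (h : k ≤ n) :
    (fun L => thicken L R)^[k] Λ ⊆ (fun L => thicken L R)^[n] Λ := by
  induction n, h using Nat.le_induction with
  | base => exact subset_rfl
  | succ n _ ih =>
    refine ih.trans ?_
    rw [Function.iterate_succ_apply']
    exact subset_thicken _ R

namespace QuasiLocalAlgebra

/-- **Locality of the cut-off commutator sum.** For `y = ι_S(B)` local and `Φ` of range `R`, in
`Σ_{X ∈ P} [ι_X(Φ X), y]` only the regions `X ∈ P` of range `≤ ⌊R⌋` meeting `S` contribute, for an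
arbitrary family `P` of regions (the others either commute with `y` by locality or carry
`Φ X = 0`). Ruelle (1969) §7.6, proof of Lemma 7.6.1; Bratteli–Robinson II Thm. 6.2.4 (proof).
[folklore] -/
theorem sum_comm_eq_sum_inter_nbhd (𝔄 : QuasiLocalAlgebra d q) {Φ : LatticeInteraction d q}
    {R : ℝ} (hR : Φ.HasFiniteRange R) (S : Finset (Site d)) (B : Op ↥S q)
    (P : Finset (Finset (Site d))) :
    ∑ X ∈ P, (𝔄.ι X (Φ X) * 𝔄.ι S B - 𝔄.ι S B * 𝔄.ι X (Φ X)) =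
      ∑ X ∈ P ∩ S.biUnion (fun x => ((box d ⌊R⌋₊).image fun w => x + w).powerset),
        (𝔄.ι X (Φ X) * 𝔄.ι S B - 𝔄.ι S B * 𝔄.ι X (Φ X)) := by
  symm
  refine Finset.sum_subset Finset.inter_subset_left fun X hXP hXn => ?_
  have hXn' : X ∉ S.biUnion (fun x => ((box d ⌊R⌋₊).image fun w => x + w).powerset) :=
    fun h => hXn (Finset.mem_inter.2 ⟨hXP, h⟩)
  by_cases hd : Disjoint X S
  · exact sub_eq_zero.2 (𝔄.ι_commute_of_disjoint hd (Φ X) B).eq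
  · obtain ⟨x, hxX, hxS⟩ := Finset.not_disjoint_iff.1 hd
    by_cases h0 : Φ X = 0
    · simp [h0]
    · exact absurd (Finset.mem_biUnion.2 ⟨x, hxS, Finset.mem_powerset.2
        (hR.subset_image_box h0 hxX)⟩) hXn'

section Cutoff

variable (𝔄 : QuasiLocalAlgebra d q) (Φ : LatticeInteraction d q) (R : ℝ)
  (P : Finset (Finset (Site d)))

/-! In the section `Cutoff`, `F` is the inner derivation of `𝔄` implemented by the cut-off
Hamiltonian `H_P = Σ_{X ∈ P} ι_X(Φ X)`, `F(y) = i Σ_{X ∈ P} [ι_X(Φ X), y] = i[H_P, y]`, for an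
arbitrary finite family `P` of regions (for `P = 𝒫(Λ')` this is the generator of the local dynamics
`e^{itH_{Λ'}} · e^{-itH_{Λ'}}`). As for `G` in `QuasiLocalAlgebraDynamicsProofs`, it enters through
the defining hypothesis `hF`, so that this file declares theorems only. -/

variable {F : 𝔄.carrier → 𝔄.carrier}
  (hF : ∀ y, F y = I • ∑ X ∈ P, (𝔄.ι X (Φ X) * y - y * 𝔄.ι X (Φ X)))

include hF

/-- The cut-off derivation and its iterates are additive. Ruelle (1969) §7.6, eq. (6.5).
[folklore] -/
theorem iterate_cutoff_sum {ι' : Type*} (s : Finset ι') (n : ℕ) (f : ι' → 𝔄.carrier) :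
    F^[n] (∑ i ∈ s, f i) = ∑ i ∈ s, F^[n] (f i) := by
  induction n generalizing f with
  | zero => rfl
  | succ n ih =>
    have h : (I • ∑ X ∈ P, (𝔄.ι X (Φ X) * (∑ i ∈ s, f i) - (∑ i ∈ s, f i) * 𝔄.ι X (Φ X))) =
        ∑ i ∈ s, I • ∑ X ∈ P, (𝔄.ι X (Φ X) * f i - f i * 𝔄.ι X (Φ X)) := by
      simp only [Finset.mul_sum, Finset.sum_mul, ← Finset.sum_sub_distrib, ← Finset.smul_sum]
      rw [Finset.sum_comm]
    simp only [Function.iterate_succ_apply, hF]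
    rw [h, ih]

/-- **Ruelle's commutator estimate, uniformly in the cut-off** (Lemma 7.6.1 of Ruelle 1969,
eq. (6.4)/(6.6), stated there for `[H_Φ(Λ), A]^{(n)}` with `Λ` arbitrary; Bratteli–Robinson II
Thm. 6.2.4, proof): if `‖ι_X(Φ X)‖ ≤ J` for all `X` and `Φ` has range `R`, then for `y = ι_S(B)` the
`n`-th iterate of `F = i[H_P, ·]` satisfies `‖F^n y‖ ≤ ‖y‖ (2 J 2^m)^n Π_{k<n} (|S| + k m)`,
`m = |box ⌊R⌋| = (2⌊R⌋+1)^d`, for every family of regions `P`.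
[cite: Ruelle1969, Lemma 7.6.1, eqs. (6.4)-(6.6), pp. 168-169] -/
theorem norm_iterate_cutoff_le {J : ℝ} (hR : Φ.HasFiniteRange R)
    (hJ : ∀ X : Finset (Site d), ‖𝔄.ι X (Φ X)‖ ≤ J) (n : ℕ) (S : Finset (Site d)) (B : Op ↥S q) :
    ‖F^[n] (𝔄.ι S B)‖ ≤
      ‖𝔄.ι S B‖ * (2 * J * 2 ^ #(box d ⌊R⌋₊)) ^ n *
        ∏ k ∈ range n, ((#S : ℝ) + k * #(box d ⌊R⌋₊)) := by
  have hJ0 : 0 ≤ J := (norm_nonneg _).trans (hJ ∅)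
  induction n generalizing S B with
  | zero => simp
  | succ n ih =>
    set m : ℕ := #(box d ⌊R⌋₊) with hm
    set N : Finset (Finset (Site d)) :=
      S.biUnion fun x => ((box d ⌊R⌋₊).image fun w => x + w).powerset with hN
    rw [Function.iterate_succ_apply, hF, 𝔄.sum_comm_eq_sum_inter_nbhd hR S B P, Finset.smul_sum]
    simp only [𝔄.comm_mem_range Φ S]
    rw [𝔄.iterate_cutoff_sum Φ P hF]
    -- the bound for each chain step
    have hterm : ∀ X ∈ P ∩ N,
        ‖F^[n] (𝔄.ι (S ∪ X)
          (I • (embedOp subset_union_right (Φ X) * embedOp subset_union_left B -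
            embedOp subset_union_left B * embedOp subset_union_right (Φ X))))‖ ≤
        2 * J * ‖𝔄.ι S B‖ * (2 * J * 2 ^ m) ^ n *
          ∏ k ∈ range n, ((#S : ℝ) + (k + 1) * m) := by
      intro X hX
      have hXN : X ∈ N := (Finset.mem_inter.1 hX).2
      refine (ih (S ∪ X) _).trans ?_
      have h1 : ‖𝔄.ι (S ∪ X) (I • (embedOp subset_union_right (Φ X) * embedOp subset_union_left B -
          embedOp subset_union_left B * embedOp subset_union_right (Φ X)))‖ ≤
          2 * J * ‖𝔄.ι S B‖ := by
        rw [← 𝔄.comm_mem_range Φ S X B, norm_smul, Complex.norm_I, one_mul]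
        refine (norm_sub_le _ _).trans ?_
        refine (add_le_add (norm_mul_le _ _) (norm_mul_le _ _)).trans ?_
        rw [mul_comm ‖𝔄.ι S B‖, ← two_mul, ← mul_assoc]
        exact mul_le_mul_of_nonneg_right (mul_le_mul_of_nonneg_left (hJ X) zero_le_two)
          (norm_nonneg _)
      have h2 : ∏ k ∈ range n, ((#(S ∪ X) : ℝ) + k * m) ≤
          ∏ k ∈ range n, ((#S : ℝ) + (k + 1) * m) := by
        refine Finset.prod_le_prod (fun k _ => by positivity) fun k _ => ?_
        have : (#(S ∪ X) : ℝ) ≤ #S + m := by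
          exact_mod_cast (Finset.card_union_le S X).trans
            (Nat.add_le_add_left (card_le_of_mem_nbhd hXN) _)
        linarith
      calc ‖𝔄.ι (S ∪ X) (I • (embedOp subset_union_right (Φ X) * embedOp subset_union_left B -
            embedOp subset_union_left B * embedOp subset_union_right (Φ X)))‖ *
            (2 * J * 2 ^ m) ^ n * ∏ k ∈ range n, ((#(S ∪ X) : ℝ) + k * m)
          ≤ (2 * J * ‖𝔄.ι S B‖) * (2 * J * 2 ^ m) ^ n *
              ∏ k ∈ range n, ((#S : ℝ) + (k + 1) * m) := by
            refine mul_le_mul (mul_le_mul_of_nonneg_right h1 (by positivity)) h2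
              (Finset.prod_nonneg fun k _ => by positivity) (by positivity)
        _ = _ := by ring
    refine (norm_sum_le _ _).trans ?_
    refine (Finset.sum_le_card_nsmul _ _ _ hterm).trans ?_
    rw [nsmul_eq_mul]
    have hcard : (#(P ∩ N) : ℝ) ≤ #S * 2 ^ m := by
      exact_mod_cast (Finset.card_le_card Finset.inter_subset_right).trans (card_nbhd_le S R)
    calc (#(P ∩ N) : ℝ) * (2 * J * ‖𝔄.ι S B‖ * (2 * J * 2 ^ m) ^ n *
          ∏ k ∈ range n, ((#S : ℝ) + (k + 1) * m))
        ≤ (#S * 2 ^ m) * (2 * J * ‖𝔄.ι S B‖ * (2 * J * 2 ^ m) ^ n *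
          ∏ k ∈ range n, ((#S : ℝ) + (k + 1) * m)) :=
          mul_le_mul_of_nonneg_right hcard (mul_nonneg (by positivity)
            (Finset.prod_nonneg fun k _ => by positivity))
      _ = ‖𝔄.ι S B‖ * (2 * J * 2 ^ m) ^ (n + 1) *
          ∏ k ∈ range (n + 1), ((#S : ℝ) + k * m) := by
          rw [Finset.prod_range_succ' (fun k => ((#S : ℝ) + k * m))]
          push_cast
          ring

/-- **Analyticity bound, uniformly in the cut-off**: `‖F^n(ι_Λ A)‖ ≤ ‖ι_Λ A‖ e^{|Λ|} n! Kⁿ` with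
`K = 2 J 2^m e^m` independent of `Λ` and of the family `P` (from `norm_iterate_cutoff_le` and
`xⁿ/n! ≤ eˣ`). Ruelle (1969) Lemma 7.6.1, eq. (6.4), p. 169; Bratteli–Robinson II Thm. 6.2.4
(proof: "the same estimate holds for `δ_Λ` uniformly in `Λ`").
[cite: Ruelle1969, Lemma 7.6.1, eq. (6.4), p. 169] -/
theorem norm_iterate_cutoff_le_factorial {J : ℝ} (hR : Φ.HasFiniteRange R)
    (hJ : ∀ X : Finset (Site d), ‖𝔄.ι X (Φ X)‖ ≤ J) (Λ : Finset (Site d)) (A : Op ↥Λ q) (n : ℕ) :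
    ‖F^[n] (𝔄.ι Λ A)‖ ≤
      ‖𝔄.ι Λ A‖ * Real.exp #Λ * n ! *
        (2 * J * 2 ^ #(box d ⌊R⌋₊) * Real.exp #(box d ⌊R⌋₊)) ^ n := by
  have hJ0 : 0 ≤ J := (norm_nonneg _).trans (hJ ∅)
  set m : ℕ := #(box d ⌊R⌋₊) with hm
  refine (𝔄.norm_iterate_cutoff_le Φ R P hF hR hJ n Λ A).trans ?_
  have hprod : ∏ k ∈ range n, ((#Λ : ℝ) + k * m) ≤ n ! * (Real.exp #Λ * Real.exp m ^ n) := by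
    have h1 : ∏ k ∈ range n, ((#Λ : ℝ) + k * m) ≤ ((#Λ : ℝ) + n * m) ^ n := by
      refine (Finset.prod_le_prod (fun k _ => by positivity) fun k hk => ?_).trans_eq
        (by rw [Finset.prod_const, Finset.card_range])
      have : (k : ℝ) ≤ n := by exact_mod_cast (Finset.mem_range.1 hk).le
      nlinarith [show (0 : ℝ) ≤ m from by positivity]
    have h2 : ((#Λ : ℝ) + n * m) ^ n / n ! ≤ Real.exp #Λ * Real.exp m ^ n := by
      rw [← Real.exp_nat_mul, ← Real.exp_add]
      exact Real.pow_div_factorial_le_exp _ (by positivity) n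
    rw [div_le_iff₀ (by positivity)] at h2
    linarith
  calc ‖𝔄.ι Λ A‖ * (2 * J * 2 ^ m) ^ n * ∏ k ∈ range n, ((#Λ : ℝ) + k * m)
      ≤ ‖𝔄.ι Λ A‖ * (2 * J * 2 ^ m) ^ n * (n ! * (Real.exp #Λ * Real.exp m ^ n)) :=
        mul_le_mul_of_nonneg_left hprod (by positivity)
    _ = _ := by ring

end Cutoff

section Stabilize

variable (𝔄 : QuasiLocalAlgebra d q) (Φ : LatticeInteraction d q) (R : ℝ)

variable {G : Finset (Site d) × 𝔄.carrier → Finset (Site d) × 𝔄.carrier}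
  (hG : ∀ (Λ' : Finset (Site d)) (y : 𝔄.carrier), G (Λ', y) =
    (thicken Λ' R, I • ∑ X ∈ (thicken Λ' R).powerset, (𝔄.ι X (Φ X) * y - y * 𝔄.ι X (Φ X))))

include hG

/-- The region carried along the iterated generator is the iterated `R`-neighbourhood
`thicken^n Λ R`. Bratteli–Robinson II Thm. 6.2.4 (proof). [folklore] -/
theorem iterate_genStep_fst (n : ℕ) (Λ : Finset (Site d)) (y : 𝔄.carrier) :
    (G^[n] (Λ, y)).1 = (fun L => thicken L R)^[n] Λ := by
  induction n generalizing Λ y with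
  | zero => rfl
  | succ n ih =>
    rw [Function.iterate_succ_apply, Function.iterate_succ_apply, hG, ih]

/-- **Stabilisation of the cut-off chains.** If the family of regions `P` contains all subregions
of the `n`-th iterated `R`-neighbourhood `Λ_n` of `Λ`, then the first `n` iterates of the cut-off
derivation `F = i[H_P, ·]` on `ι_Λ(A)` agree with the intrinsic ones `x_k = ι_{Λ_k}(δ^k A)`
(locality: only terms `Φ X` with `X ∩ Λ_k ≠ ∅`, hence `X ⊆ Λ_{k+1} ⊆ Λ_n`, contribute).
Ruelle (1969) Thm. 7.6.2 (a) ("we have term by term `lim_Λ …`"), p. 169; Bratteli–Robinson II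
Thm. 6.2.4 (proof). [cite: Ruelle1969, Thm. 7.6.2 (a), p. 169] -/
theorem iterate_cutoff_eq_iterate_genStep (hR : Φ.HasFiniteRange R)
    {P : Finset (Finset (Site d))} {F : 𝔄.carrier → 𝔄.carrier}
    (hF : ∀ y, F y = I • ∑ X ∈ P, (𝔄.ι X (Φ X) * y - y * 𝔄.ι X (Φ X)))
    (Λ : Finset (Site d)) (A : Op ↥Λ q) {n : ℕ}
    (hP : ((fun L => thicken L R)^[n] Λ).powerset ⊆ P) :
    ∀ k ≤ n, F^[k] (𝔄.ι Λ A) = (G^[k] (Λ, 𝔄.ι Λ A)).2 := by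
  intro k hk
  induction k with
  | zero => rfl
  | succ k ih =>
    have hk' : k ≤ n := (Nat.le_succ k).trans hk
    obtain ⟨L, B, hB⟩ := 𝔄.iterate_genStep_eq_ι Φ R hG k Λ A
    have hL : L = (fun L => thicken L R)^[k] Λ := by
      have h1 := congrArg Prod.fst hB
      rw [𝔄.iterate_genStep_fst Φ R hG] at h1
      exact h1.symm
    set N : Finset (Finset (Site d)) :=
      L.biUnion fun x => ((box d ⌊R⌋₊).image fun w => x + w).powerset with hN
    have hNL : N ⊆ (thicken L R).powerset := fun X hX =>
      Finset.mem_powerset.2 (subset_thicken_of_mem_nbhd subset_rfl hX)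
    have hNP : N ⊆ P := by
      refine hNL.trans (Finset.Subset.trans (Finset.powerset_mono.2 ?_) hP)
      have := thicken_iterate_mono Λ R hk
      rwa [Function.iterate_succ_apply', ← hL] at this
    rw [Function.iterate_succ_apply' F k, ih hk', Function.iterate_succ_apply' G k, hB, hG]
    dsimp only
    rw [hF, 𝔄.sum_comm_eq_sum_inter_nbhd hR L B P, Finset.inter_eq_right.2 hNP,
      𝔄.sum_comm_eq_sum_nbhd hR L B hNL]

end Stabilize

section Limit

variable (𝔄 : QuasiLocalAlgebra d q) (Φ : LatticeInteraction d q) (R : ℝ)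

/-! In the section `Limit`, `σ Λ'` is the local (cut-off) dynamics of the finite volume `Λ'`,
implemented in `𝔄`: a strongly continuous automorphism group of `𝔄` whose generator is the inner
derivation `i[H_{Λ'}, ·]`, `H_{Λ'} = Σ_{X ⊆ Λ'} ι_X(Φ X)` (hypotheses `hσ`, `hσ'`; for a Hermitian
interaction it is `e^{itH_{Λ'}} · e^{-itH_{Λ'}}`, `exists_isAutomorphismGroup_inner`). The infinite-volume
dynamics is its limit along `Λ' → ℤ^d` (`Filter.atTop` on `Finset (Site d)`), Ruelle (1969)
Thm. 7.6.2, Bratteli–Robinson II Thm. 6.2.4. -/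

variable {σ : Finset (Site d) → ℝ → (𝔄.carrier ≃⋆ₐ[ℂ] 𝔄.carrier)}
  (hσ : ∀ Λ' : Finset (Site d), IsAutomorphismGroup (σ Λ'))
  (hσ' : ∀ (Λ' : Finset (Site d)) (y : 𝔄.carrier), HasDerivAt (fun t : ℝ => σ Λ' t y)
    (I • ∑ X ∈ Λ'.powerset, (𝔄.ι X (Φ X) * y - y * 𝔄.ι X (Φ X))) 0)

include hσ hσ'

/-- **Convergence of the local dynamics on local elements, small times** (Ruelle 1969,
Thm. 7.6.2 (a); Bratteli–Robinson II Thm. 6.2.4): for `|t| K < 1` (`K = 2 J 2^m e^m` the uniform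
analyticity constant) and `A ∈ 𝔄_Λ`, the net `Λ' ↦ τ^{Λ'}_t(ι_Λ A)` converges in `𝔄` as `Λ' → ℤ^d`
(to the power series `Σ tⁿ/n! δⁿ(ι_Λ A)`): the Taylor series of `τ^{Λ'}_t(ι_Λ A)` has a geometric
tail uniformly in `Λ'` (`norm_iterate_cutoff_le_factorial`) and its terms stabilise
(`iterate_cutoff_eq_iterate_genStep`). [cite: Ruelle1969, Thm. 7.6.2 (a), p. 169] -/
theorem tendsto_cutoff_ι {J : ℝ} (hR : Φ.HasFiniteRange R)
    (hJ : ∀ X : Finset (Site d), ‖𝔄.ι X (Φ X)‖ ≤ J) {t : ℝ}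
    (ht : |t| * (2 * J * 2 ^ #(box d ⌊R⌋₊) * Real.exp #(box d ⌊R⌋₊)) < 1)
    (Λ : Finset (Site d)) (A : Op ↥Λ q) :
    ∃ L : 𝔄.carrier, Tendsto (fun Λ' => σ Λ' t (𝔄.ι Λ A)) atTop (𝓝 L) := by
  have hJ0 : 0 ≤ J := (norm_nonneg _).trans (hJ ∅)
  set K : ℝ := 2 * J * 2 ^ #(box d ⌊R⌋₊) * Real.exp #(box d ⌊R⌋₊) with hK
  have hK0 : 0 ≤ K := by positivity
  set a : 𝔄.carrier := 𝔄.ι Λ A with ha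
  set C : ℝ := ‖a‖ * Real.exp #Λ with hC
  set r : ℝ := |t| * K with hr
  have hr0 : 0 ≤ r := by positivity
  have hr1 : r < 1 := ht
  -- the intrinsic chain `x_n = ι(δⁿ A)` and its Taylor polynomials
  obtain ⟨G, hG⟩ : ∃ G : Finset (Site d) × 𝔄.carrier → Finset (Site d) × 𝔄.carrier,
      ∀ (Λ' : Finset (Site d)) (y : 𝔄.carrier), G (Λ', y) =
        (thicken Λ' R, I • ∑ X ∈ (thicken Λ' R).powerset,
          (𝔄.ι X (Φ X) * y - y * 𝔄.ι X (Φ X))) :=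
    ⟨fun p => (thicken p.1 R, I • ∑ X ∈ (thicken p.1 R).powerset,
      (𝔄.ι X (Φ X) * p.2 - p.2 * 𝔄.ι X (Φ X))), fun _ _ => rfl⟩
  set x : ℕ → 𝔄.carrier := fun n => (G^[n] (Λ, a)).2 with hx
  have hxb : ∀ n, ‖x n‖ ≤ C * n ! * K ^ n :=
    fun n => 𝔄.norm_iterate_genStep_le_factorial Φ R (G := G) hG hR hJ Λ A n
  set s : ℕ → 𝔄.carrier := fun N => ∑ n ∈ range (N + 1), (t ^ n / n ! : ℝ) • x n with hs
  have hs_cauchy : CauchySeq s :=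
    cauchySeq_of_le_geometric r (C * r) hr1 fun N => dist_taylor_succ_le x hxb t N
  obtain ⟨L, hL⟩ := cauchySeq_tendsto_of_complete hs_cauchy
  have hsL : ∀ N, dist (s N) L ≤ C * r * r ^ N / (1 - r) :=
    dist_le_of_le_geometric_of_tendsto r (C * r) hr1 (fun N => dist_taylor_succ_le x hxb t N) hL
  refine ⟨L, ?_⟩
  -- the cut-off chains: uniform tail and stabilisation
  have key : ∀ (N : ℕ) (Λ' : Finset (Site d)),
      ((fun L => thicken L R)^[N] Λ) ⊆ Λ' →
        dist (σ Λ' t a) L ≤ 2 * (C * r * r ^ N / (1 - r)) := by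
    intro N Λ' hΛ'
    set F : 𝔄.carrier → 𝔄.carrier := fun y =>
      I • ∑ X ∈ Λ'.powerset, (𝔄.ι X (Φ X) * y - y * 𝔄.ι X (Φ X)) with hFdef
    have hF : ∀ y, F y = I • ∑ X ∈ Λ'.powerset, (𝔄.ι X (Φ X) * y - y * 𝔄.ι X (Φ X)) :=
      fun y => rfl
    set y : ℕ → 𝔄.carrier := fun n => F^[n] a with hy
    have hyb : ∀ n, ‖y n‖ ≤ C * n ! * K ^ n :=
      fun n => 𝔄.norm_iterate_cutoff_le_factorial Φ R Λ'.powerset hF hR hJ Λ A n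
    have hyd : ∀ n, HasDerivAt (fun u : ℝ => σ Λ' u (y n)) (y (n + 1)) 0 := by
      intro n
      have h1 := hσ' Λ' (y n)
      rwa [← hF, hy, ← Function.iterate_succ_apply' F n a] at h1
    have hS : dist (∑ n ∈ range (N + 1), (t ^ n / n ! : ℝ) • y n) (σ Λ' t a) ≤
        C * r * r ^ N / (1 - r) := (hσ Λ').dist_taylor_le y hyd hK0 hyb ht N
    have hstab : (∑ n ∈ range (N + 1), (t ^ n / n ! : ℝ) • y n) = s N := by
      refine Finset.sum_congr rfl fun n hn => ?_
      rw [hy, hx]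
      dsimp only
      rw [𝔄.iterate_cutoff_eq_iterate_genStep Φ R hG hR hF Λ A
        (Finset.powerset_mono.2 hΛ') n (Nat.le_of_lt_succ (Finset.mem_range.1 hn))]
    calc dist (σ Λ' t a) L
        ≤ dist (σ Λ' t a) (∑ n ∈ range (N + 1), (t ^ n / n ! : ℝ) • y n) +
            dist (∑ n ∈ range (N + 1), (t ^ n / n ! : ℝ) • y n) L := dist_triangle _ _ _
      _ ≤ C * r * r ^ N / (1 - r) + C * r * r ^ N / (1 - r) := by
          refine add_le_add (by rwa [dist_comm]) ?_
          rw [hstab]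
          exact hsL N
      _ = 2 * (C * r * r ^ N / (1 - r)) := by ring
  -- conclusion
  rw [Metric.tendsto_atTop]
  intro ε hε
  have hlim : Tendsto (fun N : ℕ => 2 * (C * r * r ^ N / (1 - r))) atTop (𝓝 0) := by
    have h0 := tendsto_pow_atTop_nhds_zero_of_lt_one hr0 hr1
    have : Tendsto (fun N : ℕ => 2 * (C * r * r ^ N / (1 - r))) atTop
        (𝓝 (2 * (C * r * 0 / (1 - r)))) :=
      ((h0.const_mul (C * r)).div_const (1 - r)).const_mul 2
    simpa using this
  obtain ⟨N, hN⟩ := (hlim.eventually (gt_mem_nhds hε)).exists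
  exact ⟨(fun L => thicken L R)^[N] Λ, fun Λ' hΛ' => (key N Λ' hΛ').trans_lt hN⟩

/-- **Convergence of the local dynamics on `𝔄`, small times** (Ruelle 1969, Thm. 7.6.2 (b)): the
local algebra is dense and the `τ^{Λ'}_t` are isometries, so the net `Λ' ↦ τ^{Λ'}_t(a)` is Cauchy,
hence convergent, for every `a ∈ 𝔄` and `|t| K < 1`. [cite: Ruelle1969, Thm. 7.6.2 (b), p. 169] -/
theorem tendsto_cutoff_of_small {J : ℝ} (hR : Φ.HasFiniteRange R)
    (hJ : ∀ X : Finset (Site d), ‖𝔄.ι X (Φ X)‖ ≤ J) {t : ℝ}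
    (ht : |t| * (2 * J * 2 ^ #(box d ⌊R⌋₊) * Real.exp #(box d ⌊R⌋₊)) < 1) (a : 𝔄.carrier) :
    ∃ L : 𝔄.carrier, Tendsto (fun Λ' => σ Λ' t a) atTop (𝓝 L) := by
  refine cauchySeq_tendsto_of_complete (Metric.cauchySeq_iff.2 fun ε hε => ?_)
  obtain ⟨a₀, ha₀, hdist⟩ := 𝔄.dense_range.exists_dist_lt a (by positivity : (0 : ℝ) < ε / 3)
  obtain ⟨Λ, ⟨A, rfl⟩⟩ := Set.mem_iUnion.1 ha₀
  obtain ⟨L, hL⟩ := 𝔄.tendsto_cutoff_ι Φ R hσ hσ' hR hJ ht Λ A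
  obtain ⟨N, hN⟩ := Metric.cauchySeq_iff.1 hL.cauchySeq (ε / 3) (by positivity)
  refine ⟨N, fun m hm n hn => ?_⟩
  have hiso : ∀ Λ' : Finset (Site d), dist (σ Λ' t a) (σ Λ' t (𝔄.ι Λ A)) = dist a (𝔄.ι Λ A) :=
    fun Λ' => by rw [dist_eq_norm, dist_eq_norm, ← map_sub, StarAlgEquiv.norm_map]
  calc dist (σ m t a) (σ n t a)
      ≤ dist (σ m t a) (σ m t (𝔄.ι Λ A)) + dist (σ m t (𝔄.ι Λ A)) (σ n t (𝔄.ι Λ A)) +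
          dist (σ n t (𝔄.ι Λ A)) (σ n t a) := dist_triangle4 _ _ _ _
    _ < ε / 3 + ε / 3 + ε / 3 := by
        refine add_lt_add (add_lt_add ?_ (hN m hm n hn)) ?_
        · rwa [hiso]
        · rwa [dist_comm, hiso]
    _ = ε := by ring

/-- **Convergence of the local dynamics for all times** (Ruelle 1969, Thm. 7.6.2 (c): "we may define
`τ̄_t A` for all real `t` … then (6.9) holds for all `t`"): by the group law
`τ^{Λ'}_{s+s'} = τ^{Λ'}_s ∘ τ^{Λ'}_{s'}` and the isometry of automorphisms, convergence for
`|s|, |s'|` small gives convergence for `s + s'`, hence for all `t`.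
[cite: Ruelle1969, Thm. 7.6.2 (c), p. 169] -/
theorem tendsto_cutoff {J : ℝ} (hR : Φ.HasFiniteRange R)
    (hJ : ∀ X : Finset (Site d), ‖𝔄.ι X (Φ X)‖ ≤ J) (t : ℝ) (a : 𝔄.carrier) :
    ∃ L : 𝔄.carrier, Tendsto (fun Λ' => σ Λ' t a) atTop (𝓝 L) := by
  have hJ0 : 0 ≤ J := (norm_nonneg _).trans (hJ ∅)
  set K : ℝ := 2 * J * 2 ^ #(box d ⌊R⌋₊) * Real.exp #(box d ⌊R⌋₊) with hK
  have hK0 : 0 ≤ K := by positivity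
  -- convergence is stable under addition of times
  have hadd : ∀ s s' : ℝ, (∀ a, ∃ L : 𝔄.carrier, Tendsto (fun Λ' => σ Λ' s a) atTop (𝓝 L)) →
      (∀ a, ∃ L : 𝔄.carrier, Tendsto (fun Λ' => σ Λ' s' a) atTop (𝓝 L)) →
      ∀ a, ∃ L : 𝔄.carrier, Tendsto (fun Λ' => σ Λ' (s + s') a) atTop (𝓝 L) := by
    intro s s' h h' a
    obtain ⟨b, hb⟩ := h' a
    obtain ⟨c, hc⟩ := h b
    refine ⟨c, ?_⟩
    have : (fun Λ' => σ Λ' (s + s') a) = fun Λ' => σ Λ' s (σ Λ' s' a) :=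
      funext fun Λ' => (hσ Λ').map_add_apply s s' a
    rw [this]
    exact tendsto_starAlgEquiv_apply_of_tendsto (fun Λ' => σ Λ' s) hb hc
  -- small times, then multiples
  obtain ⟨N, hN⟩ := exists_nat_gt (|t| * K)
  have hN0 : (0 : ℝ) < N + 1 := by positivity
  set t₀ : ℝ := t / (N + 1) with ht₀
  have ht₀K : |t₀| * K < 1 := by
    rw [ht₀, abs_div, abs_of_pos hN0, div_mul_eq_mul_div, div_lt_one hN0]
    linarith
  have hk : ∀ k : ℕ, ∀ a, ∃ L : 𝔄.carrier, Tendsto (fun Λ' => σ Λ' (k * t₀) a) atTop (𝓝 L) := by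
    intro k
    induction k with
    | zero =>
      intro a
      refine ⟨a, ?_⟩
      simp only [Nat.cast_zero, zero_mul, (hσ _).map_zero_apply]
      exact tendsto_const_nhds
    | succ k ih =>
      intro a
      rw [Nat.cast_add, Nat.cast_one, add_mul, one_mul]
      exact hadd _ _ ih (fun a => 𝔄.tendsto_cutoff_of_small Φ R hσ hσ' hR hJ ht₀K a) a
  have htt : t = ((N + 1 : ℕ) : ℝ) * t₀ := by
    rw [ht₀]; push_cast; field_simp
  rw [htt]
  exact hk (N + 1) a

/-- **Uniform small-time bound for the local dynamics on local elements**: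
`‖τ^{Λ'}_t(ι_Λ A) - ι_Λ A‖ ≤ |t| ‖ι_Λ A‖ 2 J 2^m |Λ|` uniformly in `Λ'` (mean value inequality with
`‖d/dt τ^{Λ'}_t(ι_Λ A)‖ = ‖i[H_{Λ'}, ι_Λ A]‖ ≤ 2 J |Λ| 2^m ‖ι_Λ A‖`, Ruelle's estimate with `n = 1`).
Ruelle (1969) eq. (6.16), p. 171, and Thm. 7.6.2 (d); Bratteli–Robinson II Thm. 6.2.4 (proof).
[cite: Ruelle1969, eq. (6.16), p. 171] -/
theorem norm_cutoff_apply_sub_le {J : ℝ} (hR : Φ.HasFiniteRange R)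
    (hJ : ∀ X : Finset (Site d), ‖𝔄.ι X (Φ X)‖ ≤ J) (Λ' Λ : Finset (Site d)) (A : Op ↥Λ q)
    (t : ℝ) :
    ‖σ Λ' t (𝔄.ι Λ A) - 𝔄.ι Λ A‖ ≤ |t| * (‖𝔄.ι Λ A‖ * (2 * J * 2 ^ #(box d ⌊R⌋₊)) * #Λ) := by
  set F : 𝔄.carrier → 𝔄.carrier := fun y =>
    I • ∑ X ∈ Λ'.powerset, (𝔄.ι X (Φ X) * y - y * 𝔄.ι X (Φ X)) with hFdef
  have hF : ∀ y, F y = I • ∑ X ∈ Λ'.powerset, (𝔄.ι X (Φ X) * y - y * 𝔄.ι X (Φ X)) :=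
    fun y => rfl
  have hb : ‖F (𝔄.ι Λ A)‖ ≤ ‖𝔄.ι Λ A‖ * (2 * J * 2 ^ #(box d ⌊R⌋₊)) * #Λ := by
    have := 𝔄.norm_iterate_cutoff_le Φ R Λ'.powerset hF hR hJ 1 Λ A
    simpa using this
  have hd : ∀ s : ℝ, HasDerivAt (fun u : ℝ => σ Λ' u (𝔄.ι Λ A)) (σ Λ' s (F (𝔄.ι Λ A))) s :=
    fun s => (hσ Λ').hasDerivAt_of_hasDerivAt_zero (by rw [hF]; exact hσ' Λ' _) s
  have hmv := (convex_uIcc (0 : ℝ) t).norm_image_sub_le_of_norm_hasDerivWithin_le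
    (fun s _ => (hd s).hasDerivWithinAt)
    (fun s _ => by rw [StarAlgEquiv.norm_map]) Set.left_mem_uIcc Set.right_mem_uIcc
  rw [(hσ Λ').map_zero_apply, sub_zero, Real.norm_eq_abs] at hmv
  calc ‖σ Λ' t (𝔄.ι Λ A) - 𝔄.ι Λ A‖ ≤ ‖F (𝔄.ι Λ A)‖ * |t| := hmv
    _ ≤ ‖𝔄.ι Λ A‖ * (2 * J * 2 ^ #(box d ⌊R⌋₊)) * #Λ * |t| :=
        mul_le_mul_of_nonneg_right hb (abs_nonneg t)
    _ = _ := mul_comm _ _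

/-- **The infinite-volume dynamics as the limit of the local dynamics** (Ruelle 1969, Thm. 7.6.2;
Bratteli–Robinson II Thm. 6.2.4, `τ_t(A) = lim_{Λ→∞} e^{itH_Λ} A e^{-itH_Λ}`): the pointwise limits
`τ_t(a) = lim_{Λ'} τ^{Λ'}_t(a)` form a strongly continuous one-parameter group of ⋆-automorphisms of
`𝔄` (⋆-homomorphism, group law and inverses pass to the limit by isometry; strong continuity from
the uniform small-time bound on the dense local algebra). [cite: Ruelle1969, Thm. 7.6.2, pp. 169-170] -/
theorem exists_isAutomorphismGroup_tendsto_cutoff {J : ℝ} (hR : Φ.HasFiniteRange R)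
    (hJ : ∀ X : Finset (Site d), ‖𝔄.ι X (Φ X)‖ ≤ J) :
    ∃ τ : ℝ → (𝔄.carrier ≃⋆ₐ[ℂ] 𝔄.carrier), IsAutomorphismGroup τ ∧
      ∀ (t : ℝ) (a : 𝔄.carrier), Tendsto (fun Λ' => σ Λ' t a) atTop (𝓝 (τ t a)) := by
  have hJ0 : 0 ≤ J := (norm_nonneg _).trans (hJ ∅)
  choose τ₀ hτ₀ using 𝔄.tendsto_cutoff Φ R hσ hσ' hR hJ
  -- algebraic structure of the limit maps
  have hmul : ∀ (t : ℝ) (a b : 𝔄.carrier), τ₀ t (a * b) = τ₀ t a * τ₀ t b := fun t a b =>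
    tendsto_nhds_unique (hτ₀ t (a * b)) (by simpa only [map_mul] using (hτ₀ t a).mul (hτ₀ t b))
  have hadd : ∀ (t : ℝ) (a b : 𝔄.carrier), τ₀ t (a + b) = τ₀ t a + τ₀ t b := fun t a b =>
    tendsto_nhds_unique (hτ₀ t (a + b)) (by simpa only [map_add] using (hτ₀ t a).add (hτ₀ t b))
  have hstar : ∀ (t : ℝ) (a : 𝔄.carrier), τ₀ t (star a) = star (τ₀ t a) := fun t a =>
    tendsto_nhds_unique (hτ₀ t (star a)) (by simpa only [map_star] using (hτ₀ t a).star)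
  have hsmul : ∀ (t : ℝ) (c : ℂ) (a : 𝔄.carrier), τ₀ t (c • a) = c • τ₀ t a := fun t c a =>
    tendsto_nhds_unique (hτ₀ t (c • a)) (by simpa only [map_smul] using (hτ₀ t a).const_smul c)
  have hcomp : ∀ (s t : ℝ) (a : 𝔄.carrier), τ₀ (s + t) a = τ₀ s (τ₀ t a) := by
    intro s t a
    refine tendsto_nhds_unique (hτ₀ (s + t) a) ?_
    have : (fun Λ' => σ Λ' (s + t) a) = fun Λ' => σ Λ' s (σ Λ' t a) :=
      funext fun Λ' => (hσ Λ').map_add_apply s t a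
    rw [this]
    exact tendsto_starAlgEquiv_apply_of_tendsto (fun Λ' => σ Λ' s) (hτ₀ t a) (hτ₀ s (τ₀ t a))
  have hzero : ∀ a : 𝔄.carrier, τ₀ 0 a = a := fun a =>
    tendsto_nhds_unique (hτ₀ 0 a) (by simp only [(hσ _).map_zero_apply]; exact tendsto_const_nhds)
  have hinv : ∀ (t : ℝ) (a : 𝔄.carrier), τ₀ (-t) (τ₀ t a) = a := fun t a => by
    rw [← hcomp, neg_add_cancel, hzero]
  have hinv' : ∀ (t : ℝ) (a : 𝔄.carrier), τ₀ t (τ₀ (-t) a) = a := fun t a => by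
    rw [← hcomp, add_neg_cancel, hzero]
  set τ : ℝ → (𝔄.carrier ≃⋆ₐ[ℂ] 𝔄.carrier) := fun t =>
    { toFun := τ₀ t
      invFun := τ₀ (-t)
      left_inv := hinv t
      right_inv := hinv' t
      map_mul' := hmul t
      map_add' := hadd t
      map_star' := hstar t
      map_smul' := hsmul t } with hτ
  have hτapp : ∀ (t : ℝ) (a : 𝔄.carrier), τ t a = τ₀ t a := fun t a => rfl
  refine ⟨τ, ⟨?_, ?_, ?_⟩, fun t a => hτ₀ t a⟩
  · ext a
    exact hzero a
  · intro s t
    ext a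
    exact hcomp s t a
  · -- strong continuity
    intro a
    have hiso : ∀ (t : ℝ) (x : 𝔄.carrier), ‖τ₀ t x‖ = ‖x‖ := fun t x =>
      StarAlgEquiv.norm_map (τ t) x
    have hsub : ∀ (t : ℝ) (x y : 𝔄.carrier), τ₀ t (x - y) = τ₀ t x - τ₀ t y := fun t x y =>
      map_sub (τ t) x y
    have hloc : ∀ (Λ : Finset (Site d)) (A : Op ↥Λ q) (t : ℝ),
        ‖τ₀ t (𝔄.ι Λ A) - 𝔄.ι Λ A‖ ≤ |t| * (‖𝔄.ι Λ A‖ * (2 * J * 2 ^ #(box d ⌊R⌋₊)) * #Λ) :=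
      fun Λ A t => le_of_tendsto ((hτ₀ t (𝔄.ι Λ A)).sub_const (𝔄.ι Λ A)).norm
        (Filter.Eventually.of_forall fun Λ' =>
          𝔄.norm_cutoff_apply_sub_le Φ R hσ hσ' hR hJ Λ' Λ A t)
    -- continuity at `0`
    have h0 : Tendsto (fun t : ℝ => τ₀ t a) (𝓝 0) (𝓝 a) := by
      rw [Metric.tendsto_nhds_nhds]
      intro ε hε
      obtain ⟨a₀, ha₀, hdist⟩ := 𝔄.dense_range.exists_dist_lt a (by positivity : (0 : ℝ) < ε / 3)
      obtain ⟨Λ, ⟨A, rfl⟩⟩ := Set.mem_iUnion.1 ha₀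
      set M : ℝ := ‖𝔄.ι Λ A‖ * (2 * J * 2 ^ #(box d ⌊R⌋₊)) * #Λ with hM
      have hM0 : 0 ≤ M := by positivity
      refine ⟨ε / 3 / (M + 1), by positivity, fun t ht => ?_⟩
      rw [dist_zero_right, Real.norm_eq_abs] at ht
      have e1 : ‖τ₀ t (a - 𝔄.ι Λ A)‖ = dist a (𝔄.ι Λ A) := by rw [hiso, dist_eq_norm]
      have e3 : ‖𝔄.ι Λ A - a‖ = dist a (𝔄.ι Λ A) := by rw [dist_comm, dist_eq_norm]
      have h1 : ‖τ₀ t a - a‖ ≤ 2 * dist a (𝔄.ι Λ A) + |t| * M := by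
        calc ‖τ₀ t a - a‖
            = ‖τ₀ t (a - 𝔄.ι Λ A) + (τ₀ t (𝔄.ι Λ A) - 𝔄.ι Λ A) + (𝔄.ι Λ A - a)‖ := by
              rw [hsub]; abel_nf
          _ ≤ ‖τ₀ t (a - 𝔄.ι Λ A)‖ + ‖τ₀ t (𝔄.ι Λ A) - 𝔄.ι Λ A‖ + ‖𝔄.ι Λ A - a‖ :=
              norm_add₃_le
          _ ≤ dist a (𝔄.ι Λ A) + |t| * M + dist a (𝔄.ι Λ A) := by
              have hl := hloc Λ A t
              rw [← hM] at hl
              rw [e1, e3]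
              linarith
          _ = 2 * dist a (𝔄.ι Λ A) + |t| * M := by ring
      have h2 : |t| * M < ε / 3 := by
        calc |t| * M ≤ ε / 3 / (M + 1) * M := mul_le_mul_of_nonneg_right ht.le hM0
          _ < ε / 3 := by
              rw [div_mul_eq_mul_div, div_lt_iff₀ (by positivity)]
              nlinarith
      rw [dist_eq_norm]
      linarith
    -- continuity everywhere, by the group law
    refine continuous_iff_continuousAt.2 fun t₀ => ?_
    change Tendsto (fun t : ℝ => τ₀ t a) (𝓝 t₀) (𝓝 (τ₀ t₀ a))
    have hs : Tendsto (fun t : ℝ => t - t₀) (𝓝 t₀) (𝓝 0) := by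
      simpa using (continuous_sub_right t₀).tendsto t₀
    have h3 := ((StarAlgEquiv.isometry (τ t₀)).continuous.tendsto a).comp (h0.comp hs)
    refine Tendsto.congr (fun t => ?_) h3
    change τ₀ t₀ (τ₀ (t - t₀) a) = τ₀ t a
    rw [← hcomp, add_sub_cancel]

/-- **The generator of the limit dynamics on local elements** (Bratteli–Robinson II Thm. 6.2.4,
eq. (6.2.9): `𝔄_Λ ⊆ D(δ)` and `δ(A) = i[H_{Λ_R}, A]`): for `A ∈ 𝔄_Λ`,
`d/dt τ_t(ι_Λ A)|_{t=0} = ι_{Λ_R}(i[H_{Λ_R}, A])`. For `Λ' ⊇ (Λ_R)_R` the local dynamics satisfy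
`‖τ^{Λ'}_t(a) - a - t δ(a)‖ ≤ t² ‖δ²(a)‖` (mean value inequality twice, the generator of `τ^{Λ'}`
acting on `a` and `δ(a)` by the intrinsic `δ`, `iterate_cutoff_eq_iterate_genStep`), and the bound
passes to the limit. [cite: BratteliRobinsonII1997, Thm. 6.2.4] -/
theorem hasDerivAt_of_tendsto_cutoff (hR : Φ.HasFiniteRange R)
    {τ : ℝ → (𝔄.carrier ≃⋆ₐ[ℂ] 𝔄.carrier)} (hτ : IsAutomorphismGroup τ)
    (hlim : ∀ (t : ℝ) (a : 𝔄.carrier), Tendsto (fun Λ' => σ Λ' t a) atTop (𝓝 (τ t a)))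
    (Λ : Finset (Site d)) (A : Op ↥Λ q) :
    HasDerivAt (fun t : ℝ => τ t (𝔄.ι Λ A)) (𝔄.ι (thicken Λ R) (derivation Φ R Λ A)) 0 := by
  obtain ⟨G, hG⟩ : ∃ G : Finset (Site d) × 𝔄.carrier → Finset (Site d) × 𝔄.carrier,
      ∀ (Λ' : Finset (Site d)) (y : 𝔄.carrier), G (Λ', y) =
        (thicken Λ' R, I • ∑ X ∈ (thicken Λ' R).powerset,
          (𝔄.ι X (Φ X) * y - y * 𝔄.ι X (Φ X))) :=
    ⟨fun p => (thicken p.1 R, I • ∑ X ∈ (thicken p.1 R).powerset,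
      (𝔄.ι X (Φ X) * p.2 - p.2 * 𝔄.ι X (Φ X))), fun _ _ => rfl⟩
  -- `a = ι_Λ A`, `b = δ(a)`, `b' = δ²(a)`
  obtain ⟨a, ha⟩ : ∃ a : 𝔄.carrier, 𝔄.ι Λ A = a := ⟨_, rfl⟩
  obtain ⟨b, hb⟩ : ∃ b : 𝔄.carrier, 𝔄.ι (thicken Λ R) (derivation Φ R Λ A) = b := ⟨_, rfl⟩
  obtain ⟨b', hb'⟩ : ∃ b' : 𝔄.carrier, (G^[2] (Λ, a)).2 = b' := ⟨_, rfl⟩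
  have hG1 : (G^[1] (Λ, a)).2 = b := by
    rw [Function.iterate_one, ← ha, hG, ← 𝔄.ι_derivation, hb]
  -- the bound for the local dynamics, `Λ'` large
  have bound : ∀ Λ' : Finset (Site d), (fun L => thicken L R)^[2] Λ ⊆ Λ' → ∀ t : ℝ,
      ‖σ Λ' t a - a - t • b‖ ≤ t ^ 2 * ‖b'‖ := by
    intro Λ' hΛ' t
    set F : 𝔄.carrier → 𝔄.carrier := fun y =>
      I • ∑ X ∈ Λ'.powerset, (𝔄.ι X (Φ X) * y - y * 𝔄.ι X (Φ X)) with hFdef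
    have hF : ∀ y, F y = I • ∑ X ∈ Λ'.powerset, (𝔄.ι X (Φ X) * y - y * 𝔄.ι X (Φ X)) :=
      fun y => rfl
    have hstab := 𝔄.iterate_cutoff_eq_iterate_genStep Φ R hG hR hF Λ A
      (Finset.powerset_mono.2 hΛ')
    rw [ha] at hstab
    have hFa : F a = b := by
      rw [← hG1, ← hstab 1 (by norm_num), Function.iterate_one]
    have hFb : F b = b' := by
      rw [← hb', ← hstab 2 le_rfl, Function.iterate_succ_apply', Function.iterate_one, hFa]
    have hda : ∀ s : ℝ, HasDerivAt (fun u : ℝ => σ Λ' u a) (σ Λ' s b) s :=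
      fun s => (hσ Λ').hasDerivAt_of_hasDerivAt_zero (by rw [← hFa, hF]; exact hσ' Λ' a) s
    have hdb : ∀ s : ℝ, HasDerivAt (fun u : ℝ => σ Λ' u b) (σ Λ' s b') s :=
      fun s => (hσ Λ').hasDerivAt_of_hasDerivAt_zero (by rw [← hFb, hF]; exact hσ' Λ' b) s
    -- `‖σ_s b - b‖ ≤ ‖b'‖ |s|`
    have h1 : ∀ s : ℝ, ‖σ Λ' s b - b‖ ≤ ‖b'‖ * |s| := by
      intro s
      have hmv := (convex_uIcc (0 : ℝ) s).norm_image_sub_le_of_norm_hasDerivWithin_le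
        (fun u _ => (hdb u).hasDerivWithinAt)
        (fun u _ => by rw [StarAlgEquiv.norm_map]) Set.left_mem_uIcc Set.right_mem_uIcc
      rwa [(hσ Λ').map_zero_apply, sub_zero, Real.norm_eq_abs] at hmv
    -- `g(s) = σ_s a - s • b` has derivative `σ_s b - b`, of norm `≤ ‖b'‖ |t|` on `[0, t]`
    have h2 : ∀ s : ℝ, HasDerivAt (fun u : ℝ => σ Λ' u a - u • b) (σ Λ' s b - b) s := by
      intro s
      have h := (hda s).sub ((hasDerivAt_id s).smul_const b)
      simp only [id, one_smul] at h
      exact h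
    have hmv := (convex_uIcc (0 : ℝ) t).norm_image_sub_le_of_norm_hasDerivWithin_le
      (fun u _ => (h2 u).hasDerivWithinAt)
      (fun u hu => (h1 u).trans (mul_le_mul_of_nonneg_left
        (by simpa using Set.abs_sub_left_of_mem_uIcc hu) (norm_nonneg _)))
      Set.left_mem_uIcc Set.right_mem_uIcc
    rw [(hσ Λ').map_zero_apply, zero_smul, sub_zero, sub_zero, Real.norm_eq_abs] at hmv
    calc ‖σ Λ' t a - a - t • b‖ = ‖σ Λ' t a - t • b - a‖ := by abel_nf
      _ ≤ ‖b'‖ * |t| * |t| := hmv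
      _ = t ^ 2 * ‖b'‖ := by rw [mul_assoc, ← sq_abs, pow_two]; ring
  -- pass to the limit
  have hlim_bound : ∀ t : ℝ, ‖τ t a - a - t • b‖ ≤ t ^ 2 * ‖b'‖ := by
    intro t
    refine le_of_tendsto (((hlim t a).sub_const a).sub_const (t • b)).norm ?_
    exact (Filter.eventually_ge_atTop ((fun L => thicken L R)^[2] Λ)).mono
      fun Λ' hΛ' => bound Λ' hΛ' t
  rw [ha, hb, hasDerivAt_iff_isLittleO_nhds_zero]
  simp only [zero_add, hτ.map_zero_apply]
  refine Asymptotics.IsBigO.trans_isLittleO (g := fun h : ℝ => h ^ 2) ?_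
    (Asymptotics.isLittleO_pow_id one_lt_two)
  refine Asymptotics.IsBigO.of_bound ‖b'‖ (Filter.Eventually.of_forall fun h => ?_)
  rw [Real.norm_eq_abs, abs_pow, sq_abs, mul_comm]
  exact hlim_bound h

end Limit

/-! ### Discharge of `exists_dynamics` -/

/-- **Discharge of `QuasiLocalAlgebra.exists_dynamics` (Bratteli–Robinson II Thm. 6.2.4; Ruelle 1969
Thm. 7.6.2): existence and uniqueness of the dynamics of a bounded finite-range Hermitian
interaction.** Existence: the local dynamics `τ^{Λ'}_t = e^{itH_{Λ'}} · e^{-itH_{Λ'}}` implemented in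
`𝔄` (`exists_isAutomorphismGroup_inner` with `H_{Λ'} = Σ_{X ⊆ Λ'} ι_X(Φ X)`, self-adjoint since `Φ`
is Hermitian) converge as `Λ' → ℤ^d` to a strongly continuous automorphism group `τ`
(`exists_isAutomorphismGroup_tendsto_cutoff`) whose generator on `ι(𝔄_Λ)` is the commutator
derivation (`hasDerivAt_of_tendsto_cutoff`). Uniqueness: `IsDynamicsOf.eq_of_isDynamicsOf`
(analyticity of local elements). The bound `‖ι_X(Φ X)‖ ≤ ‖Φ X‖ ≤ J` uses that ⋆-homomorphisms of
C⋆-algebras are contractive. [cite: BratteliRobinsonII1997, Thm. 6.2.4] -/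
theorem exists_dynamics_holds (𝔄 : QuasiLocalAlgebra d q) : 𝔄.exists_dynamics := by
  intro Φ R J hH hR hb
  have hJ : ∀ X : Finset (Site d), ‖𝔄.ι X (Φ X)‖ ≤ J := fun X => by
    letI : CStarAlgebra (Op ↥X q) := { }
    exact (NonUnitalStarAlgHom.norm_apply_le (𝔄.ι X) (Φ X)).trans (hb X)
  -- the local dynamics, implemented in `𝔄`
  have hsa : ∀ Λ' : Finset (Site d), IsSelfAdjoint (∑ X ∈ Λ'.powerset, 𝔄.ι X (Φ X)) := by
    intro Λ'
    refine isSelfAdjoint_sum Λ'.powerset fun X _ => ?_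
    rw [IsSelfAdjoint, ← map_star, Matrix.star_eq_conjTranspose, (hH X).eq]
  choose σ hσ _hσf hσd using fun Λ' : Finset (Site d) => exists_isAutomorphismGroup_inner (hsa Λ')
  have hσ' : ∀ (Λ' : Finset (Site d)) (y : 𝔄.carrier), HasDerivAt (fun t : ℝ => σ Λ' t y)
      (I • ∑ X ∈ Λ'.powerset, (𝔄.ι X (Φ X) * y - y * 𝔄.ι X (Φ X))) 0 := by
    intro Λ' y
    convert hσd Λ' y using 2
    rw [Finset.sum_mul, Finset.mul_sum, Finset.sum_sub_distrib]
  obtain ⟨τ, hτ, hlim⟩ := 𝔄.exists_isAutomorphismGroup_tendsto_cutoff Φ R hσ hσ' hR hJ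
  refine ⟨τ, ⟨hτ, fun Λ A => 𝔄.hasDerivAt_of_tendsto_cutoff Φ R hσ hσ' hR hτ hlim Λ A⟩, ?_⟩
  intro τ' hτ'
  exact IsDynamicsOf.eq_of_isDynamicsOf 𝔄 Φ R hτ'
    ⟨hτ, fun Λ A => 𝔄.hasDerivAt_of_tendsto_cutoff Φ R hσ hσ' hR hτ hlim Λ A⟩ hR hJ

end QuasiLocalAlgebra

end QLattice

end Literature.MathematicalPhysics.QuantumLattice
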